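import Summits.Langlands.Langlands.Theorems.MonodromyRankLadderJRankMaxGeneric
import Summits.Langlands.Langlands.Theorems.MonodromyRankLadderJTwist
import HarnessLib

/-!
# Proof of `MonodromyRankLadder.GenericIffRankMaximal` (stmt-Langlands-27783)

Support item (rank 9) of route `route-Langlands-MonodromyRankLadder`
(`Summits/Langlands/Langlands/Theses/MonodromyRankLadder.lean`): with `ρ` Frobenius-semisimple and
fixed, `(ρ, N)` is generic (A'Campo–Hevesi–Thorne–Whitmore 2026, Def. 6.0.4:
`Hom_WD((ρ,N),(ρ(1),N)) = 0`) **iff** `rank N ^ k` is maximal among all `(ρ, N')` for every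
`k ≥ 1`.
## Proof
Part IV (`exists_twist`) moves everything to the twisted graded semisimple `C[W_F]`-module of
`ρ`: admissible `N'` ↔ graded degree `+1` endomorphisms, WD-genericity ↔ graded genericity, and
`rank (N' ^ k)` is the `C`-dimension of the image of the corresponding endomorphism power
(`finrank_range_pow_eq_of_semiconj`).  There, generic ⇒ rank-maximal is part I
(`finrank_range_pow_le_of_generic`: openness of genericity on lines + conjugacy of generic
operators + lower semicontinuity of ranks) and rank-maximal ⇒ generic is part III
(`generic_of_rankMax`).
lens-2 g26 node twin (decomp-langlands), 2026-08-31.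
-/

set_option linter.dupNamespace false

namespace Summit.Langlands.Langlands.Theorems

namespace RankLadderJ

open Module
open Literature.NumberTheory.GaloisRepresentations
open Literature.NumberTheory.GaloisRepresentations.WeilGroup
open Literature.NumberTheory.GaloisRepresentations.IsNonarchimedeanLocalField

/-- Ranks of powers are transported along a semiconjugacy by a linear equivalence. -/
theorem finrank_range_pow_eq_of_semiconj {C : Type*} [Field C] {R : Type*} [Ring R] [Algebra C R]
    {M : Type*} [AddCommGroup M] [Module C M] [Module R M] [IsScalarTower C R M]
    {V : Type*} [AddCommGroup V] [Module C V]
    (e : M ≃ₗ[C] V) (tt : M →ₗ[R] M) (Nop : V →ₗ[C] V) (h : ∀ x, e (tt x) = Nop (e x)) (k : ℕ) :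
    finrank C (LinearMap.range (Nop ^ k)) = finrank C (LinearMap.range (tt ^ k)) := by
  have hk : ∀ x, e ((tt ^ k) x) = (Nop ^ k) (e x) := by
    induction k with
    | zero => intro x; simp
    | succ k ih =>
      intro x
      rw [pow_succ', pow_succ', Module.End.mul_apply, Module.End.mul_apply, h, ih]
  have hmap : ((LinearMap.range (tt ^ k)).restrictScalars C).map (e : M →ₗ[C] V) =
      LinearMap.range (Nop ^ k) := by
    ext v
    simp only [Submodule.mem_map, Submodule.restrictScalars_mem, LinearMap.mem_range,
      LinearEquiv.coe_coe]
    constructor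
    · rintro ⟨x, ⟨y, rfl⟩, rfl⟩
      exact ⟨e y, (hk y).symm⟩
    · rintro ⟨u, rfl⟩
      exact ⟨(tt ^ k) (e.symm u), ⟨_, rfl⟩, by rw [hk, LinearEquiv.apply_symm_apply]⟩
  rw [← finrank_restrictScalars_R (K := C) (LinearMap.range (tt ^ k)), ← hmap]
  exact (LinearEquiv.finrank_eq (e.submoduleMap _)).symm

/-- `stmt-Langlands-27783` proved by name: for a Frobenius-semisimple Weil–Deligne representation
`(ρ, N)`, genericity is equivalent to maximality of `rank (N ^ k)` (all `k ≥ 1`) among the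
Weil–Deligne representations with the same `ρ`. [A'Campo–Hevesi–Thorne–Whitmore, arXiv:2607.11763,
Def. 6.0.4 / Prop. 6.0.5; Vogan 1993, doi:10.1090/conm/145/1216197, Prop. 4.5] -/
theorem GenericIffRankMaximal_proof :
    Summit.Langlands.Langlands.Theses.MonodromyRankLadder.GenericIffRankMaximal := by
  intro F _ _ _ _ C _ _ _ V _ _ _ W' hss
  classical
  obtain ⟨ρt, grR, Nb, hssMod, hindR, hsupR, hNbR, hT1, hT2, hT3⟩ := exists_twist W' hss
  haveI := hssMod
  obtain ⟨tR, htR, htRdeg⟩ := hT1 W'.N W'.conj_N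
  have hrk : ∀ (W'' : WeilDeligneRep F C V)
      (tt : ρt.asModule →ₗ[MonoidAlgebra C (WeilGroup F)] ρt.asModule),
      (∀ x, ρt.asModuleEquiv (tt x) = W''.N (ρt.asModuleEquiv x)) →
      ∀ k, finrank C (LinearMap.range (W''.N ^ k)) = finrank C (LinearMap.range (tt ^ k)) :=
    fun W'' tt h k => finrank_range_pow_eq_of_semiconj ρt.asModuleEquiv tt W''.N h k
  constructor
  · intro hgen W'' hρ'' k _
    have hconj'' : ∀ w, W'.ρ w ∘ₗ W''.N =
        ((residueFieldCard F : C) ^ (deg w)) • (W''.N ∘ₗ W'.ρ w) := fun w => by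
      have := W''.conj_N w; rwa [hρ''] at this
    obtain ⟨tR'', htR'', htR''deg⟩ := hT1 W''.N hconj''
    have hgenR := (hT3 W'.N tR htR).mp hgen
    rw [hrk W'' tR'' htR'', hrk W' tR htR]
    exact finrank_range_pow_le_of_generic (K := C) grR hindR hsupR Nb hNbR tR htRdeg hgenR tR''
      htR''deg k
  · intro hmax
    refine (hT3 W'.N tR htR).mpr ?_
    refine generic_of_rankMax (K := C) grR hindR hsupR Nb hNbR tR htRdeg fun t' ht' k hk => ?_
    obtain ⟨Nop, hconj, hnil, hcorr⟩ := hT2 t' ht'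
    let W'' : WeilDeligneRep F C V := ⟨W'.ρ, W'.isContinuous, Nop, hnil, hconj⟩
    have := hmax W'' rfl k hk
    rw [hrk W'' t' hcorr, hrk W' tR htR] at this
    exact this

end RankLadderJ

end Summit.Langlands.Langlands.Theorems
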